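import Literature.NumberTheory.AdelicBaseChange.PadicTensorCompletionProofs
import Literature.NumberTheory.Automorphic.GaloisActionPlaces
import Mathlib.RingTheory.Trace.Basic
import HarnessLib

/-!
# The semi-local algebra `ℚ_p ⊗_ℚ L ≅ ∏_{w ∣ p} L_w`, IV: Galois transport — `Ψ ∘ (1 ⊗ σ) = σ_w ∘ Ψ`

`Proofs` file (theorems only, no definitions, no named facts) in topic `NumberTheory/AdelicBaseChange`;
continuation of `PadicTensorCompletionProofs` (I: the `ℚ`-algebra isomorphism
`Ψ : ℚ_[p] ⊗[ℚ] L ≃ₐ[ℚ] ∏_{w ∣ v_p} L_w` with `Ψ(s ⊗ x)_w = x · e_p(s)`, Cassels–Fröhlich II §10 (10.2))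
and of `Literature.NumberTheory.Automorphic.GaloisActionPlaces` (the transport of completions
`σ_w : L_w → L_{σ w}` along `σ ∈ Aut(L/K)`, Cassels–Fröhlich VII §1.1).

* `galAdicCompletionMap_algebraMap_adicCompletion` — **`σ_w` is `K_v`-linear**: for number fields
  `F ⊆ E`, `σ ∈ Aut(E/F)`, places `w, w' ∣ v` of `E` with `σ • w = w'`, the transport `E_w → E_{w'}`
  fixes the image of `F_v` (Cassels–Fröhlich VII §1.1: "this map is a `K_v`-isomorphism"; the file
  `GaloisActionPlaces` records `F`-linearity only; `F` is dense in `F_v` and both sides are continuous).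
* `trace_galAdicCompletionMap` — hence **`σ_w` preserves the local traces**:
  `Tr_{E_{w'}/F_v}(σ_w x) = Tr_{E_w/F_v}(x)` (`σ_w` is an `F_v`-algebra isomorphism; Mathlib
  `Algebra.trace_eq_of_algEquiv`), and the local integers (`GaloisActionPlaces`).
* `padicTensor_map_galois` — **`Ψ` intertwines `1 ⊗ σ` with the transport of completions**:
  `Ψ((1 ⊗ σ) t)_{w'} = σ_w (Ψ(t)_w)` whenever `σ • w = w'`, for every `ℚ`-algebra map `Ψ` with the
  pure-tensor formula (on pure tensors both sides are `σ(x) · e_p(s)`; additivity).  This is how the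
  `Gal(ℚ(ζ_m)/ℚ)`-action `1 ⊗ σ_b` on the value module `ℚ_p ⊗ ℚ(ζ_m)` of Kato's dual-exponential datum
  (`Kato2004.ZetaBody` (C3a)) reads factor by factor: it PERMUTES the places above `p` and transports the
  values along `σ_w` (consumer: the equivariance clause (C3a) for a per-factor DEFINED `exp*`, cell
  `bsd-addord`, crux `KatoKuriharaPortThreeShared`).

## References

* [CasselsFrohlichANT1967] J. W. S. Cassels, A. Fröhlich (eds.), *Algebraic Number Theory* (1967),
  Ch. II §10 (10.2) (`L ⊗_K K_v ≅ ∏_{w ∣ v} L_w`) and Ch. VII §1.1 (action of the Galois group on primes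
  and completions: "`σ` induces by continuity an isomorphism `σ_w : L_w → L_{σ w}` … a `K_v`-isomorphism").
-/

noncomputable section

open scoped TensorProduct NumberField
open IsDedekindDomain NumberField Literature.NumberTheory.Automorphic

namespace Literature.NumberTheory.AdelicBaseChange

/-! ## `σ_w : E_w → E_{σ w}` is `F_v`-linear -/

section Linear

variable {F E : Type*} [Field F] [NumberField F] [Field E] [NumberField E] [Algebra F E]
  (v : HeightOneSpectrum (𝓞 F))

/-- **`σ_w : E_w → E_{σ w}` is `F_v`-linear** (`σ ∈ Aut(E/F)`, `w, w' ∣ v`, `σ • w = w'`): it sends the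
image of `s ∈ F_v` in `E_w` to its image in `E_{w'}` (both sides are continuous in `s` and agree on the
dense subfield `F ⊆ F_v`, where it is `GaloisActionPlaces.galAdicCompletionMap_algebraMap`).
[cite: CasselsFrohlichANT1967, Ch. VII §1.1] -/
theorem galAdicCompletionMap_algebraMap_adicCompletion (σ : E ≃ₐ[F] E) (w w' : v.Extension (𝓞 E))
    (h : σ • w.1 = w'.1) (s : v.adicCompletion F) :
    galAdicCompletionMap σ h (algebraMap (v.adicCompletion F) (w.1.adicCompletion E) s) =
      algebraMap (v.adicCompletion F) (w'.1.adicCompletion E) s := by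
  have hc : Continuous (algebraMap (v.adicCompletion F) (w.1.adicCompletion E)) :=
    continuous_algebraMap _ _
  have hc' : Continuous (algebraMap (v.adicCompletion F) (w'.1.adicCompletion E)) :=
    continuous_algebraMap _ _
  refine congrFun (HeightOneSpectrum.adicCompletion.ext_of_coe F v
    ((continuous_galAdicCompletionMap E σ h).comp hc) hc' fun x => ?_) s
  have h1 : algebraMap (v.adicCompletion F) (w.1.adicCompletion E) (x : v.adicCompletion F) =
      ((algebraMap F E x : E) : w.1.adicCompletion E) :=
    w.adicCompletionSemialgHom_coe F E (WithVal.toVal (v.valuation F) x)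
  have h2 : algebraMap (v.adicCompletion F) (w'.1.adicCompletion E) (x : v.adicCompletion F) =
      ((algebraMap F E x : E) : w'.1.adicCompletion E) :=
    w'.adicCompletionSemialgHom_coe F E (WithVal.toVal (v.valuation F) x)
  simp only [Function.comp_apply]
  rw [h1, h2, galAdicCompletionMap_algebraMap]

/-- **`σ_w` preserves the local traces**: `Tr_{E_{w'}/F_v}(σ_w x) = Tr_{E_w/F_v}(x)` for `σ • w = w'`
(`σ_w : E_w ≃ E_{w'}` is an `F_v`-algebra isomorphism by `galAdicCompletionMap_algebraMap_adicCompletion`;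
Mathlib `Algebra.trace_eq_of_algEquiv`). [cite: CasselsFrohlichANT1967, Ch. VII §1.1] -/
theorem trace_galAdicCompletionMap (σ : E ≃ₐ[F] E) (w w' : v.Extension (𝓞 E)) (h : σ • w.1 = w'.1)
    (x : w.1.adicCompletion E) :
    Algebra.trace (v.adicCompletion F) (w'.1.adicCompletion E) (galAdicCompletionMap σ h x) =
      Algebra.trace (v.adicCompletion F) (w.1.adicCompletion E) x :=
  Algebra.trace_eq_of_algEquiv
    (AlgEquiv.ofRingEquiv (f := galAdicCompletionEquiv σ h)
      (galAdicCompletionMap_algebraMap_adicCompletion v σ w w' h)) x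

end Linear

/-! ## `Ψ ∘ (1 ⊗ σ) = σ_w ∘ Ψ` -/

section Galois

variable {L : Type} [Field L] [NumberField L] {p : ℕ} [Fact p.Prime]

set_option backward.isDefEq.respectTransparency false in
/-- **`Ψ` intertwines `1 ⊗ σ` with the transport of completions**: for a `ℚ`-algebra map
`Ψ : ℚ_[p] ⊗[ℚ] L → ∏_{w ∣ v_p} L_w` with the pure-tensor formula, `σ ∈ Aut(L/ℚ)` and places
`w, w' ∣ v_p` with `σ • w = w'`: `Ψ((1 ⊗ σ) t)_{w'} = σ_w (Ψ(t)_w)` (the action on the value module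
permutes the places and transports the values). [cite: CasselsFrohlichANT1967, Ch. II §10 Theorem (10.2) and Ch. VII §1.1] -/
theorem padicTensor_map_galois
    (Ψ : ℚ_[p] ⊗[ℚ] L →ₐ[ℚ]
      (Π w : ((Rat.HeightOneSpectrum.primesEquiv (R := 𝓞 ℚ)).symm ⟨p, Fact.out⟩).Extension (𝓞 L),
        w.1.adicCompletion L))
    (hΨ : ∀ (s : ℚ_[p]) (x : L)
      (w : ((Rat.HeightOneSpectrum.primesEquiv (R := 𝓞 ℚ)).symm ⟨p, Fact.out⟩).Extension (𝓞 L)),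
      Ψ (s ⊗ₜ[ℚ] x) w = algebraMap L (w.1.adicCompletion L) x *
        algebraMap (((Rat.HeightOneSpectrum.primesEquiv (R := 𝓞 ℚ)).symm ⟨p, Fact.out⟩).adicCompletion ℚ)
          (w.1.adicCompletion L) (Padic.adicCompletionEquiv (𝓞 ℚ) ⟨p, Fact.out⟩ s))
    (σ : L ≃ₐ[ℚ] L)
    (w w' : ((Rat.HeightOneSpectrum.primesEquiv (R := 𝓞 ℚ)).symm ⟨p, Fact.out⟩).Extension (𝓞 L))
    (h : σ • w.1 = w'.1) (t : ℚ_[p] ⊗[ℚ] L) :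
    Ψ (Algebra.TensorProduct.map (AlgHom.id ℚ ℚ_[p]) (σ : L →ₐ[ℚ] L) t) w' =
      galAdicCompletionMap σ h (Ψ t w) := by
  -- the structure map `L → L_w` is the coercion
  have hcoe : ∀ (u : ((Rat.HeightOneSpectrum.primesEquiv (R := 𝓞 ℚ)).symm ⟨p, Fact.out⟩).Extension (𝓞 L))
      (y : L), algebraMap L (u.1.adicCompletion L) y = (y : u.1.adicCompletion L) := fun _ _ => rfl
  induction t using TensorProduct.induction_on with
  | zero => simp
  | tmul s x =>
    rw [Algebra.TensorProduct.map_tmul, AlgHom.id_apply, hΨ, hΨ, map_mul,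
      galAdicCompletionMap_algebraMap_adicCompletion _ σ w w' h, hcoe, hcoe,
      galAdicCompletionMap_coe_algEquiv ℚ σ h x]
    rfl
  | add t₁ t₂ h₁ h₂ => simp only [map_add, Pi.add_apply, h₁, h₂]

end Galois

end Literature.NumberTheory.AdelicBaseChange

end
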